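import Summits.KontsevichZagierPeriods.Zeta5Search.WellPoisedFaceTailLaiData
import Summits.KontsevichZagierPeriods.Zeta5Search.WellPoisedFaceOddGrowthFree
import HarnessLib

/-!
# Well-poised face forms with `B` tail bricks — Lemma 19's SHARP WINDOWS:
# `D_{M₁}³ D_{M₂} ⋯ D_{M_B} · F(h_n) ∈ ℤ + ℤζ(5) + ℤζ(7) + ⋯ + ℤζ(B+1)`

pub-zeta5 · fam-vwp generation 8, file 9b (part 2 of the sharp windows; part 1 = `WellPoisedFaceTailLaiData`).
(v2, fam-vwp g9: `IntFaceDir.two_tail_lt` is NOT re-declared here — the identical tree theorem of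
`WellPoisedFaceOddGrowthFree` (fam-odd gen 8, file C) is imported instead, so that this module and the growth
modules can be imported together; every other byte is generation 8's file, sha256 `ee877abb…`.)
HONEST FRAMING: systematic search; no irrationality claim unless certified.  Nothing here is evidence about
`ζ(5)` (or any `ζ(s)`).

`WellPoisedFaceTailOddWindow` (fam-odd) proved the MEANING of the general face theorem with the crude frame
denominator: `D_{η₀n}^{B+2} · F(h_n) ∈ ℤ + Σ_{s odd, 5 ≤ s ≤ B+1} ℤζ(s)` for `B` even tail bricks, and hence that
the normalised forms `Λ_n = D(n)Φ(h_n)⁻¹F(h_n)` of `WellPoisedFaceOddGrowth` lie in the `ℚ`-span.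
[Zudilin2004, Lemma 19] has the sharp denominator `D_{M₁}³ D_{M₂} ⋯ D_{M_B} · Φ⁻¹`,
`M_j = n · max(η₀ − 2η_(1), η₀ − η_(j))` for the SORTED direction `η_(1) ≤ ⋯ ≤ η_(B) < η₀/2`.  This file is the
`B`-brick version of fam-vwp 7 (`WellPoisedFaceWindows`, `B = 4`): it proves the WINDOW part of that refinement,

* `IntFaceDir.faceD_mul_tailF_mem` — `D(n) · F(h_n) ∈ ℤ + Σ_{s odd, 5≤s≤M+3} ℤζ(s)` for every integral face
  direction `E : IntFaceDir M` (`B = M + 2` tails) with sorted tails, `M ≥ 1` even, every `n`, where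
  `D(n) = D_{M₁}³ D_{M₂} ⋯ D_{M_{M+2}}` is EXACTLY the `faceD` of `WellPoisedFaceOddGrowth`;
* `IntFaceDir.facePhi_mul_faceLambda_tailF_mem` — equivalently `Φ(h_n) · Λ_n` lies in that `ℤ`-span.

The `Φ⁻¹` saving is file 10 (`WellPoisedFaceTailPhi`).

## Method (verbatim port of fam-vwp 7 with `Fin 4 ↦ Fin B`)
Part 1 supplies Lai face data `ĉ_{o,p}` (the face IS Lai's box at `r = 0`, `J = B`) with
`D_{(η₀−2η_(1))n}^{B−1−o} · ĉ_{o,p} ∈ ℤ` ((8.10)) and `ĉ_{o,p} ≠ 0 ⇒ η_o n ≤ p ≤ (η₀ − η_o)n`.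
`WellPoisedFaceTailLinearForms.tailF_eq_coef` gives
`F = Σ_{o<B} A_o ζ(o+3) − A₀` with `A_o = binom(o+2,2) Σ_p ĉ_{o,p}`, `A₀ = Σ_{o,p} binom(o+2,2) ĉ_{o,p} H_p^{(o+3)}`,
the orders `o = 0` and `o` odd vanish (`tail_sum_order_zero`, `tail_sum_vanish`), and the bookkeeping of
[Zudilin2004, p. 19] (`D_{M₁}⋯D_{M_{o+3}} · H_p^{(o+3)} ∈ ℤ` for `p ≤ (η₀−η_o)n ≤ M_i`,
`D_{m₀}^{B−1−o} ∣ D_{M_{o+4}} ⋯ D_{M_{B+2}}`) is `facePi_term_isInt`.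
-/

noncomputable section

open Finset Filter Polynomial

/-! ## 1. The sharp denominator on an integral face direction -/

namespace Summit.KontsevichZagierPeriods.Zeta5Search.WellPoisedFace.IntFaceDir

open Literature.NumberTheory.Transcendental (zetaValue lcmUpto_dvd_lcmUpto)
open Literature.NumberTheory.Transcendental.BallRivoal (IsInt harm)
open Summit.KontsevichZagierPeriods.Zeta5Search.WellPoisedFaceRate (tailF etaB etaB_fin etaB_of_lt etaB_mono
  tailCoef tailConst laiTailData exists_laiTailData tailDataOf tailRQ_eq_pfEval tailData_isInt tailData_window
  tailF_eq_coef tail_sum_order_zero tail_sum_vanish tri_int tailCoef_den exists_int_sum sum_oddWindow_eq)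
open DualSeriesLemma19 (isInt_prod_mul_harm)

variable {M : ℕ} (E : IntFaceDir M) (n : ℕ)

/-- The `M + 4` factors of `D(n)`, slot `i ↦` tail `i − 2` (truncated): `dSlot n i = D_{μ(η_{(i−2)}) n}`,
`μ(x) = max(η₀ − 2η₄, η₀ − x)`; slots `0, 1, 2` carry the cube `D_{M₁}³`. -/
def dSlot (n i : ℕ) : ℕ := Nat.lcmUpto (E.mu (etaB E.tail (i - 2)) * n)

/-- `Π(n) := ∏_{i < M+4} dSlot n i = D_{M₁}³ D_{M₂} ⋯ D_{M_{M+2}}`. -/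
def facePi (n : ℕ) : ℕ := ∏ i ∈ range (M + 4), E.dSlot n i

/-- **`D(n) = Π(n)`**: the denominator `faceD` of `WellPoisedFaceOddGrowth` is the slot product. -/
theorem faceD_eq_facePi (n : ℕ) : E.faceD n = E.facePi n := by
  have e0 : etaB E.tail 0 = E.tail 0 := by simpa using etaB_fin E.tail 0
  have ed : etaB E.tail (M + 1) = E.tail (Fin.last (M + 1)) := by simpa using etaB_fin E.tail (Fin.last (M + 1))
  have em : ∀ j : Fin M, etaB E.tail ((j : ℕ) + 1) = E.tail j.succ.castSucc := fun j => by
    rw [etaB_of_lt E.tail _ (by omega)]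
    exact congrArg E.tail (Fin.ext (by simp))
  rw [faceD_eq, facePi, show M + 4 = 3 + (M + 1) by ring, prod_range_add, mul_assoc]
  simp only [IntFaceDir.a, IntFaceDir.mid, IntFaceDir.d]
  congr 1
  · simp only [prod_range_succ, prod_range_zero, one_mul, dSlot, Nat.reduceSub, Nat.sub_self, e0]
    ring
  · rw [← Fin.prod_univ_eq_prod_range (fun k => E.dSlot n (3 + k)) (M + 1), Fin.prod_univ_castSucc]
    congr 1
    · refine prod_congr rfl fun j _ => ?_
      simp only [dSlot, Fin.val_castSucc]
      rw [show 3 + (j : ℕ) - 2 = (j : ℕ) + 1 by omega, em]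
    · simp only [dSlot, Fin.val_last]
      rw [show 3 + M - 2 = M + 1 by omega, ed]

/-- Every slot is a multiple of `D_{m₀}`, `m₀ = (η₀ − 2η_(1))·n`. -/
theorem dSlot_dvd_base (n i : ℕ) : Nat.lcmUpto ((E.η₀ - 2 * etaB E.tail 0) * n) ∣ E.dSlot n i := by
  have e0 : etaB E.tail 0 = E.tail 0 := by simpa using etaB_fin E.tail 0
  rw [e0]
  unfold dSlot mu IntFaceDir.a
  exact lcmUpto_dvd_lcmUpto (Nat.mul_le_mul_right n (le_max_left _ _))

/-- The first `o + 3` slots are multiples of `D_{(η₀ − η_o)n}` (slot `i − 2 ≤ o`, sorted tails). -/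
theorem dSlot_dvd_window (hs : Monotone E.tail) {o : ℕ} (ho : o < M + 2) {i : ℕ} (hi : i < o + 3) (n : ℕ) :
    Nat.lcmUpto ((E.η₀ - etaB E.tail o) * n) ∣ E.dSlot n i := by
  unfold dSlot mu
  exact lcmUpto_dvd_lcmUpto (Nat.mul_le_mul_right n
    ((Nat.sub_le_sub_left (etaB_mono E.tail hs (show i - 2 ≤ o by omega) ho) E.η₀).trans (le_max_right _ _)))

/-! ## 2. Term-by-term integrality ([Zudilin2004, p. 19]) -/

/-- **`Π · ĉ_{o,p} · H_p^{(o+3)} ∈ ℤ`**: split `Π = (∏_{i<o+3} dSlot i) · (∏_{o+3≤i<M+4} dSlot i)`; the first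
factor clears `H_p^{(o+3)}` (`p ≤ (η₀−η_o)n` by the window, `isInt_prod_mul_harm`), the second is a multiple of
`D_{m₀}^{M+1−o}`, which clears `ĉ_{o,p}` by (8.10). -/
theorem facePi_term_isInt (hs : Monotone E.tail) {c : ℕ → ℕ → ℚ} (hc : c ∈ laiTailData E.η₀ E.tail n)
    {o : ℕ} (ho : o < M + 2) (p : ℕ) :
    ∃ z : ℤ, ((E.facePi n : ℕ) : ℚ) * (tailDataOf E.η₀ E.tail n c o p * harm (o + 3) p) = z := by
  by_cases hz : tailDataOf E.η₀ E.tail n c o p = 0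
  · exact ⟨0, by rw [hz]; simp⟩
  obtain ⟨-, hhi⟩ := tailData_window E.η₀ E.tail n hs E.two_tail_lt hc ho hz
  have hsplit : ((E.facePi n : ℕ) : ℚ)
      = (∏ i ∈ range (o + 3), (E.dSlot n i : ℚ)) * ∏ i ∈ Ico (o + 3) (M + 4), (E.dSlot n i : ℚ) := by
    rw [facePi, Nat.cast_prod, prod_range_mul_prod_Ico _ (show o + 3 ≤ M + 4 by omega)]
  obtain ⟨z₁, hz₁⟩ := isInt_prod_mul_harm (range (o + 3)) (E.dSlot n) p (fun i hi l hl1 hlp =>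
    (DualSeriesDenominators.natCast_dvd_lcmUpto hl1 (hlp.trans hhi)).trans
      (Int.natCast_dvd_natCast.2 (E.dSlot_dvd_window hs ho (mem_range.1 hi) n)))
  rw [card_range] at hz₁
  have hdvd : Nat.lcmUpto ((E.η₀ - 2 * etaB E.tail 0) * n) ^ (M + 1 - o)
      ∣ ∏ i ∈ Ico (o + 3) (M + 4), E.dSlot n i := by
    have e : (∏ _i ∈ Ico (o + 3) (M + 4), Nat.lcmUpto ((E.η₀ - 2 * etaB E.tail 0) * n))
        = Nat.lcmUpto ((E.η₀ - 2 * etaB E.tail 0) * n) ^ (M + 1 - o) := by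
      rw [prod_const, Nat.card_Ico, show M + 4 - (o + 3) = M + 1 - o by omega]
    rw [← e]
    exact prod_dvd_prod_of_dvd _ _ fun i _ => E.dSlot_dvd_base n i
  obtain ⟨Q, hQ⟩ := hdvd
  obtain ⟨z₂, hz₂⟩ := tailData_isInt E.η₀ E.tail n hs E.two_tail_lt (by omega) hc o p
  rw [show M + 2 - 1 - o = M + 1 - o by omega] at hz₂
  have hQ' : (∏ i ∈ Ico (o + 3) (M + 4), (E.dSlot n i : ℚ))
      = ((Nat.lcmUpto ((E.η₀ - 2 * etaB E.tail 0) * n) : ℕ) : ℚ) ^ (M + 1 - o) * (Q : ℚ) := by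
    rw [← Nat.cast_prod, hQ]; push_cast; ring
  refine ⟨z₁ * (Q * z₂), ?_⟩
  rw [hsplit, hQ']
  push_cast
  rw [← hz₁, ← hz₂]
  ring

/-- `Π · A_o ∈ ℤ` for every order `o` (indeed `D_{m₀}^{M+1−o} · A_o ∈ ℤ` and `D_{m₀}^{M+4} ∣ Π`). -/
theorem facePi_mul_tailCoef (hs : Monotone E.tail) {c : ℕ → ℕ → ℚ} (hc : c ∈ laiTailData E.η₀ E.tail n)
    (o : ℕ) : ∃ z : ℤ, ((E.facePi n : ℕ) : ℚ) * tailCoef (E.η₀ * n) (tailDataOf E.η₀ E.tail n c) o = z := by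
  obtain ⟨z, hz⟩ := tailCoef_den (E.η₀ * n) (M + 2) (Nat.lcmUpto ((E.η₀ - 2 * etaB E.tail 0) * n)) _
    (tailData_isInt E.η₀ E.tail n hs E.two_tail_lt (by omega) hc) o
  rw [show M + 2 - 1 - o = M + 1 - o by omega] at hz
  have hdvd : Nat.lcmUpto ((E.η₀ - 2 * etaB E.tail 0) * n) ^ (M + 1 - o) ∣ E.facePi n := by
    have h4 : Nat.lcmUpto ((E.η₀ - 2 * etaB E.tail 0) * n) ^ (M + 4) ∣ E.facePi n := by
      have e : (∏ _i ∈ range (M + 4), Nat.lcmUpto ((E.η₀ - 2 * etaB E.tail 0) * n))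
          = Nat.lcmUpto ((E.η₀ - 2 * etaB E.tail 0) * n) ^ (M + 4) := by rw [prod_const, card_range]
      rw [← e]
      exact prod_dvd_prod_of_dvd _ _ fun i _ => E.dSlot_dvd_base n i
    exact (pow_dvd_pow _ (by omega)).trans h4
  obtain ⟨Q, hQ⟩ := hdvd
  refine ⟨Q * z, ?_⟩
  rw [hQ]
  push_cast
  rw [← hz]
  ring

/-- `Π · A₀ ∈ ℤ` (`binom(o+2,2) ∈ ℤ` times `facePi_term_isInt`, summed). -/
theorem facePi_mul_tailConst (hs : Monotone E.tail) {c : ℕ → ℕ → ℚ} (hc : c ∈ laiTailData E.η₀ E.tail n) :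
    ∃ z : ℤ, ((E.facePi n : ℕ) : ℚ) * tailConst (E.η₀ * n) (M + 2) (tailDataOf E.η₀ E.tail n c) = z := by
  have h : ∀ p ∈ range (E.η₀ * n + 1), ∃ z : ℤ, ((E.facePi n : ℕ) : ℚ) * ∑ o ∈ range (M + 2),
      ((o : ℚ) + 1) * ((o : ℚ) + 2) / 2 * (tailDataOf E.η₀ E.tail n c o p * harm (o + 3) p) = z := by
    intro p _
    have h' : ∀ o ∈ range (M + 2), ∃ z : ℤ, ((E.facePi n : ℕ) : ℚ)
        * (((o : ℚ) + 1) * ((o : ℚ) + 2) / 2 * (tailDataOf E.η₀ E.tail n c o p * harm (o + 3) p)) = z := by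
      intro o ho
      obtain ⟨m, hm⟩ := tri_int o
      obtain ⟨z, hz⟩ := E.facePi_term_isInt n hs hc (mem_range.1 ho) p
      refine ⟨m * z, ?_⟩
      rw [hm]
      push_cast
      rw [← hz]
      ring
    obtain ⟨z, hz⟩ := exists_int_sum _ _ h'
    exact ⟨z, by rw [← hz, mul_sum]⟩
  obtain ⟨z, hz⟩ := exists_int_sum _ _ h
  exact ⟨z, by rw [← hz, tailConst, mul_sum]⟩

/-! ## 3. The theorems -/

/-- **THEOREM (Lemma 19's sharp windows on a `B`-brick face, kernel).**  For every integral face direction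
`E : IntFaceDir M` with SORTED tails (`M ≥ 1` even, i.e. the `q = M + 5 = 9, 11, …` boxes) and every `n`:
`D(n) · F(h_n) = Σ_{s odd, 5≤s≤M+3} a_s ζ(s) − b` with `a_s, b ∈ ℤ`, where `D(n) = D_{M₁}³D_{M₂}⋯D_{M_{M+2}}` is the
`faceD` of `WellPoisedFaceOddGrowth` and `F(h_n) = tailF E.η₀ E.tail n` ([Zudilin2004, Lemma 19] without the `Φ⁻¹`;
the frame version with `D_{η₀n}^{M+4}` is fam-odd's `tailF_mem_odd`). -/
theorem faceD_mul_tailF_mem (hs : Monotone E.tail) (hM1 : 1 ≤ M) (hMe : Even M) (n : ℕ) :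
    ∃ a : ℕ → ℤ, ∃ b : ℤ, (E.faceD n : ℝ) * tailF E.η₀ E.tail n
      = (∑ s ∈ (Ioc 3 (M + 4)).filter Odd, (a s : ℝ) * zetaValue s) - (b : ℝ) := by
  have hη := E.two_tail_lt
  have hB : 3 ≤ M + 2 := by omega
  obtain ⟨c, hc⟩ := exists_laiTailData E.η₀ E.tail n hB hη
  have hc' := tailRQ_eq_pfEval E.η₀ E.tail n hη hc
  have hF := tailF_eq_coef hB hη hc'
  have h0 : tailCoef (E.η₀ * n) (tailDataOf E.η₀ E.tail n c) 0 = 0 := by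
    rw [tailCoef, tail_sum_order_zero hB hη hc', mul_zero]
  have hodd : ∀ o, o < M + 2 → Odd o → tailCoef (E.η₀ * n) (tailDataOf E.η₀ E.tail n c) o = 0 := by
    intro o ho hoo
    rw [tailCoef, tail_sum_vanish hB hη hc' o ho (((hMe.add even_two).mul_right _).add_odd hoo), mul_zero]
  choose za hza using fun o => E.facePi_mul_tailCoef n hs hc o
  obtain ⟨zb, hzb⟩ := E.facePi_mul_tailConst n hs hc
  refine ⟨fun s => za (s - 3), zb, ?_⟩
  have hD : (E.faceD n : ℝ) = ((E.facePi n : ℕ) : ℝ) := by rw [E.faceD_eq_facePi]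
  have eb : ((E.facePi n : ℕ) : ℝ) * (tailConst (E.η₀ * n) (M + 2) (tailDataOf E.η₀ E.tail n c) : ℝ)
      = (zb : ℝ) := by
    have := congrArg (fun q : ℚ => (q : ℝ)) hzb
    push_cast at this
    exact this
  have hw : ∑ o ∈ range (M + 2), ((((E.facePi n : ℕ) : ℚ) * tailCoef (E.η₀ * n) (tailDataOf E.η₀ E.tail n c) o
        : ℚ) : ℝ) * zetaValue (o + 3)
      = ∑ s ∈ (Ioc 3 (M + 4)).filter Odd, ((((E.facePi n : ℕ) : ℚ)
          * tailCoef (E.η₀ * n) (tailDataOf E.η₀ E.tail n c) (s - 3) : ℚ) : ℝ) * zetaValue s :=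
    sum_oddWindow_eq (fun o => ((E.facePi n : ℕ) : ℚ) * tailCoef (E.η₀ * n) (tailDataOf E.η₀ E.tail n c) o)
      (by rw [h0, mul_zero]) (fun o ho hoo => by rw [hodd o ho hoo, mul_zero])
  beta_reduce
  rw [hD, hF, mul_sub, eb, mul_sum]
  congr 1
  calc ∑ o ∈ range (M + 2), ((E.facePi n : ℕ) : ℝ)
        * ((tailCoef (E.η₀ * n) (tailDataOf E.η₀ E.tail n c) o : ℝ) * zetaValue (o + 3))
      = ∑ o ∈ range (M + 2), ((((E.facePi n : ℕ) : ℚ) * tailCoef (E.η₀ * n) (tailDataOf E.η₀ E.tail n c) o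
          : ℚ) : ℝ) * zetaValue (o + 3) := by
        refine sum_congr rfl fun o _ => ?_
        push_cast
        ring
    _ = _ := hw
    _ = ∑ s ∈ (Ioc 3 (M + 4)).filter Odd, (za (s - 3) : ℝ) * zetaValue s := by
        refine sum_congr rfl fun s _ => ?_
        rw [hza (s - 3)]
        norm_cast

/-- **COROLLARY.** `Φ(h_n) · Λ_n ∈ ℤ + Σ_{s odd, 5≤s≤M+3} ℤζ(s)` for the normalised face forms
`Λ_n = D(n)Φ(h_n)⁻¹F(h_n)` of `WellPoisedFaceOddGrowth` (`faceLambda`, which tend to `+∞`: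
`faceLambda_faceForm_tendsto_atTop`).  [Zudilin2004, Lemma 19] removes the factor `Φ(h_n)` (file 10).  Either way
nothing follows about any `ζ(s)`. -/
theorem facePhi_mul_faceLambda_tailF_mem (hs : Monotone E.tail) (hM1 : 1 ≤ M) (hMe : Even M) (n : ℕ) :
    ∃ a : ℕ → ℤ, ∃ b : ℤ, (E.facePhi n : ℝ) * E.faceLambda (tailF E.η₀ E.tail) n
      = (∑ s ∈ (Ioc 3 (M + 4)).filter Odd, (a s : ℝ) * zetaValue s) - (b : ℝ) := by
  obtain ⟨a, b, h⟩ := E.faceD_mul_tailF_mem hs hM1 hMe n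
  refine ⟨a, b, ?_⟩
  have hΦ : (E.facePhi n : ℝ) ≠ 0 := by exact_mod_cast (E.facePhi_pos n).ne'
  rw [faceLambda, ← h]
  field_simp

/-- Kernel instance, `q = 9` (window `{ζ5, ζ7}`): the MODEL integral face direction
`modelFace9Int = (93; 0³, 22, 25, 28, 31, 34, 37)` of fam-odd 5 — `D(n) · F(h_n) = a₅ζ(5) + a₇ζ(7) − b`,
`a₅, a₇, b ∈ ℤ`, every `n`, with `D(n) = D_{71n}³ D_{68n} D_{65n} D_{62n} D_{59n} D_{56n}` (frame bound: `D_{93n}⁸`). -/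
example (n : ℕ) : ∃ a : ℕ → ℤ, ∃ b : ℤ,
    (modelFace9Int.faceD n : ℝ) * tailF modelFace9Int.η₀ modelFace9Int.tail n
      = (a 5 : ℝ) * zetaValue 5 + (a 7 : ℝ) * zetaValue 7 - (b : ℝ) := by
  obtain ⟨a, b, h⟩ :=
    modelFace9Int.faceD_mul_tailF_mem (Fin.monotone_iff_le_succ.2 (by decide)) (by norm_num) ⟨2, rfl⟩ n
  refine ⟨a, b, ?_⟩
  rw [h, show (Ioc 3 (4 + 4)).filter Odd = {5, 7} by decide, sum_pair (by norm_num)]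

/-- Kernel instance: the growing normalised forms `Λ_n` of `modelFace9Int` satisfy
`Φ(h_n) · Λ_n ∈ ℤ + ℤζ(5) + ℤζ(7)`. -/
example (n : ℕ) : ∃ a : ℕ → ℤ, ∃ b : ℤ,
    (modelFace9Int.facePhi n : ℝ) * modelFace9Int.faceLambda (tailF modelFace9Int.η₀ modelFace9Int.tail) n
      = (a 5 : ℝ) * zetaValue 5 + (a 7 : ℝ) * zetaValue 7 - (b : ℝ) := by
  obtain ⟨a, b, h⟩ := modelFace9Int.facePhi_mul_faceLambda_tailF_mem
    (Fin.monotone_iff_le_succ.2 (by decide)) (by norm_num) ⟨2, rfl⟩ n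
  refine ⟨a, b, ?_⟩
  rw [h, show (Ioc 3 (4 + 4)).filter Odd = {5, 7} by decide, sum_pair (by norm_num)]

end Summit.KontsevichZagierPeriods.Zeta5Search.WellPoisedFace.IntFaceDir
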